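import Summits.ResolutionOfSingularities.ResolutionOfSingularities.Theorems.DeltaCutStellarHypSafe
import Summits.ResolutionOfSingularities.ResolutionOfSingularities.Theorems.DeltaCutStellarHasse

/-!
# StellarCut N23b — «Exact»: the EXACT-FACE ROUND LEMMA for the unit-free hypersurface shape — the near-point bound with
# exponent `e := n` fed with the higher-order Hasse guard (lens-6 «barrier-complement carving», g37 door 4)

T17b (`DeltaCutStellarHypSafe`) transforms the unit-free shape `ncHypShapeF n` through the blow-up of a SAFE face (heavy ∨ tame
marking ∨ labels on the face `0` or units of the stalks): the near-point bound (T10c) with `e := 2` and a first-order guard.  At a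
TIGHT face whose labels are all divisible by the residue characteristic the first-order guard is DEAD — and the bound `e = 2` is
FALSE there (N23e §TightFace: `1 + T_z²T_w² ∈ 𝔪_𝔮²` at `𝔮 = (T_z + 1, T_w + 1)` over `𝔽₂`).  THIS FILE runs the SAME near-point
bound with the EXACT exponent `e := n = M.mult` and the Hasse guard of N23a (`fibreForm_notMem_pow'`):

* `ExactFace n X E T := n < weightOf E T ∨ ∀ K ∈ T, ∀ y ∈ V(K), expOf E K = 0 ∨ expOf E K % n ≠ 0` — a HEAVY face, or a face NO
  member of which carries a label that is a positive multiple of the marking (at a TIGHT face, `weightOf E T = n`, this says every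
  label on the face is `< n`: two members at least carry the weight);
* `ncHypShapeF.not_stalkIdeal_transform_le_pow_of_exact` — over the centre and off `V(H')`, `𝓘'_{x'} ⊄ 𝔪_{x'}ⁿ`;
  `ncHypShapeF.support_transform_subset_of_exact` (`supp M' ⊆ V(H')`), ★ `ncHypShapeF.transform_of_exact` — the shape survives the
  blow-up of an EXACT face through `H` of weight `≥ n` (`n ≥ 1`; NO hypothesis on the characteristic or on the residues of the
  labels); `ncHypShapeF.transform_of_safe_or_exact`.

0 sorry; axioms standard. [new] [cite: EGAIV4, Thm. 16.11.2] [cite: CossartPiltant2008, Prop. 4.2 (a)] [cite: Kollar2007, (3.111) Step 3]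
-/
noncomputable section

open CategoryTheory CategoryTheory.Limits AlgebraicGeometry TopologicalSpace IsLocalRing
open Literature.AlgebraicGeometry.Resolution

namespace Summit.ResolutionOfSingularities.ResolutionOfSingularities.Theorems.DeltaCutClasses

open Summit.ResolutionOfSingularities.ResolutionOfSingularities.Theorems
open WeakOrderReduction ForcedTowerClasses

/-- **`ExactFace n X E T` — the face `T` is EXACT for the marking `n`**: it is HEAVY (`n < weightOf E T`), or NO member `K ∈ T`
carries, at a point of `V(K)`, a label `expOf E K` that is a POSITIVE MULTIPLE of `n` (`expOf E K = 0 ∨ expOf E K % n ≠ 0`).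
At a tight face (`weightOf E T = n`) every exponent of the fibre form is then `< n`, and the EXACT Hasse guard (N23a) applies in
every characteristic.  DEFINITION. [new] -/
def ExactFace (n : ℕ) (X : Scheme.{0}) (E : List (X.IdealSheafData × ℕ)) (T : Finset X.IdealSheafData) : Prop :=
  n < weightOf E T ∨ ∀ K ∈ T, ∀ y : X, y ∈ K.support → expOf E K = 0 ∨ expOf E K % n ≠ 0

/-- a heavy face is exact. -/
theorem exactFace_of_lt {n : ℕ} {X : Scheme.{0}} {E : List (X.IdealSheafData × ℕ)} {T : Finset X.IdealSheafData}
    (h : n < weightOf E T) : ExactFace n X E T :=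
  Or.inl h

section Fibre

variable {X X' : Scheme.{0}} [IsLocallyNoetherian X] {π : X' ⟶ X} {H : X.IdealSheafData}
  {E : List (X.IdealSheafData × ℕ)} {T : Finset X.IdealSheafData} {n : ℕ} {M : MarkedIdeal X}

set_option maxHeartbeats 400000 in
/-- **THE EXACT-FACE GUARD.**  For a `ncHypShapeF n`-datum (`n ≠ 0`) and the blow-up `π` of an EXACT face through `H` of weight
`≥ n`: at every point `x'` OVER THE CENTRE and OFF `V(H')` (any residue field, any characteristic), `𝓘'_{x'} ⊄ 𝔪_{x'}ⁿ` — the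
near-point bound (T10c) WITH `e := n`, fed with the fibre form (`exists_fibre_data'`: heavy ⇒ cofactor in `𝔪`, tight ⇒ exponents =
labels on the face, so `< n` by exactness) and the exact fibre guard `fibreForm_notMem_pow'` (N23a). [new]
[cite: EGAIV4, Thm. 16.11.2] [cite: CossartPiltant2008, Prop. 4.2 (a)] -/
theorem ncHypShapeF.not_stalkIdeal_transform_le_pow_of_exact (hEs : HasSNC (H :: boundaryOf E))
    (hT : ∀ K ∈ T, K ∈ H :: boundaryOf E) (hHT : H ∈ T) (hπ : IsBlowup π (T.sup id)) (hmT : n ≤ weightOf E T) (hn : n ≠ 0)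
    (hexact : ExactFace n X E T) (hP : ncHypShapeF n X E H M) {x' : X'} (hxC : π x' ∈ (T.sup id).support)
    (hx' : x' ∉ (strictTransformIdeal π (T.sup id) H).support) :
    ¬ stalkIdeal (M.transform π (T.sup id)).ideal x' ≤ maximalIdeal (X'.presheaf.stalk x') ^ n := by
  classical
  haveI : IsProper π := hπ.isProper
  haveI : IsLocallyNoetherian X' := LocallyOfFiniteType.isLocallyNoetherian π
  obtain ⟨k, c, lH, b, a, hc, hcspan, hHc, hblH, hbn, hFJ, hheavy, htight⟩ := hP.exists_fibre_data' hEs hT hHT hmT hxC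
  have hyT : ∀ K ∈ T, π x' ∈ K.support := (mem_support_finsetSup_iff T (π x')).mp hxC
  have hexact' : a ∈ maximalIdeal _ ∨ ∀ l, b l < n := by
    rcases hmT.lt_or_eq with hlt | heq
    · exact Or.inl (hheavy hlt)
    · rcases hexact with hlt | hlab
      · exact Or.inl (hheavy hlt)
      · refine Or.inr fun l => ?_
        obtain ⟨K, hK, hbl⟩ := htight heq.symm l
        have hle : b l ≤ n := by rw [← hbn]; exact Finsupp.le_degree l b
        rcases hlab K hK (π x') (hyT K hK) with h0 | hmod
        · rw [hbl, h0]; exact Nat.pos_of_ne_zero hn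
        · refine lt_of_le_of_ne hle fun hbeq => hmod ?_
          rw [← hbl, hbeq, Nat.mod_self]
  rw [MarkedIdeal.transform_ideal, hP.mult_eq]
  refine IsBlowup.not_stalkIdeal_controlledTransform_le_pow_of_fibre hπ c hcspan (IsRsopPart.isQuasiRegular' hc)
    (IsRsopPart.mem_maximalIdeal hc) ((MvPolynomial.isHomogeneous_X_pow lH n).add (MvPolynomial.isHomogeneous_monomial _ hbn))
    hFJ n {lH} (fun l hl => ?_) fun j 𝔮 _ h𝔮 => fibreForm_notMem_pow' hn lH b hblH hbn a hexact' j 𝔮 h𝔮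
  rw [Set.mem_singleton_iff.mp hl]
  exact map_stalkIdeal_finsetSup_eq_span_of_not_mem hEs hT hHT hπ hx' hHc

/-- **`supp M' ⊆ V(H')` after an EXACT face round, for `n ≥ 1`** (off the centre: local isomorphism and `V(H)` lifts; over the
centre: the exact-face guard — a point of `supp M'` has `𝓘'_{x'} ⊆ 𝔪_{x'}ⁿ` ON THE NOSE, `n = M'.mult`). [new]
[cite: CossartPiltant2008, Prop. 4.2 (a)] -/
theorem ncHypShapeF.support_transform_subset_of_exact (hEs : HasSNC (H :: boundaryOf E))
    (hT : ∀ K ∈ T, K ∈ H :: boundaryOf E) (hHT : H ∈ T) (hπ : IsBlowup π (T.sup id)) (hmT : n ≤ weightOf E T) (hn : n ≠ 0)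
    (hexact : ExactFace n X E T) (hP : ncHypShapeF n X E H M) :
    (M.transform π (T.sup id)).support ⊆ ((strictTransformIdeal π (T.sup id) H).support : Set X') := by
  haveI : IsProper π := hπ.isProper
  haveI : IsLocallyNoetherian X' := LocallyOfFiniteType.isLocallyNoetherian π
  intro x' hx'
  have hx'' : x' ∈ (M.transform π (T.sup id)).support := hx'
  by_cases hxC : π x' ∈ (T.sup id).support
  · by_contra hxH
    refine hP.not_stalkIdeal_transform_le_pow_of_exact hEs hT hHT hπ hmT hn hexact hxC hxH ?_
    have h := (MarkedIdeal.mem_support_iff _ _).mp hx''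
    rwa [MarkedIdeal.transform_mult, hP.mult_eq] at h
  · exact mem_support_strictTransformIdeal_of_not_mem hxC
      (hP.support_subset ((hπ.mem_support_transform_iff_of_not_mem M hxC).mp hx''))

/-- ★ **THE EXACT-FACE ROUND LEMMA**: the unit-free hypersurface shape survives the blow-up of an EXACT face through `H` of weight
`≥ n` (`n ≥ 1`) — in EVERY characteristic, with NO hypothesis on the residues of the labels. [new] [cite: EGAIV4, Thm. 16.11.2]
[cite: Kollar2007, (3.111) Step 3] [cite: CossartPiltant2008, Prop. 4.2 (a)] -/
theorem ncHypShapeF.transform_of_exact (hEs : HasSNC (H :: boundaryOf E)) (hT : ∀ K ∈ T, K ∈ H :: boundaryOf E) (hHT : H ∈ T)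
    (hπ : IsBlowup π (T.sup id)) (hmT : n ≤ weightOf E T) (hn : n ≠ 0) (hexact : ExactFace n X E T)
    (hP : ncHypShapeF n X E H M) :
    ncHypShapeF n X' (transformExp E π T n) (strictTransformIdeal π (T.sup id) H) (M.transform π (T.sup id)) :=
  hP.transform_of_support_subset hEs hT hHT hπ hmT (hP.support_transform_subset_of_exact hEs hT hHT hπ hmT hn hexact)

/-- **SAFE ∨ EXACT round lemma** (`n ≥ 2`): T17b's safe-face round lemma and the exact-face round lemma side by side. [new] -/
theorem ncHypShapeF.transform_of_safe_or_exact (hEs : HasSNC (H :: boundaryOf E)) (hT : ∀ K ∈ T, K ∈ H :: boundaryOf E)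
    (hHT : H ∈ T) (hπ : IsBlowup π (T.sup id)) (hmT : n ≤ weightOf E T) (hn : 2 ≤ n) (h : SafeFace n X E T ∨ ExactFace n X E T)
    (hP : ncHypShapeF n X E H M) :
    ncHypShapeF n X' (transformExp E π T n) (strictTransformIdeal π (T.sup id) H) (M.transform π (T.sup id)) := by
  rcases h with hs | he
  · exact hP.transform_of_safe hEs hT hHT hπ hmT hn hs
  · exact hP.transform_of_exact hEs hT hHT hπ hmT (by omega) he

-- a HEAVY face round needs neither safety nor exactness data beyond its weight (consistency check).
example (hEs : HasSNC (H :: boundaryOf E)) (hT : ∀ K ∈ T, K ∈ H :: boundaryOf E) (hHT : H ∈ T)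
    (hπ : IsBlowup π (T.sup id)) (hlt : n < weightOf E T) (hn : n ≠ 0) (hP : ncHypShapeF n X E H M) :
    ncHypShapeF n X' (transformExp E π T n) (strictTransformIdeal π (T.sup id) H) (M.transform π (T.sup id)) :=
  hP.transform_of_exact hEs hT hHT hπ hlt.le hn (exactFace_of_lt hlt)

end Fibre

end Summit.ResolutionOfSingularities.ResolutionOfSingularities.Theorems.DeltaCutClasses
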